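import Summits.CriticalPhenomena.PercolationContinuityZ3.Theorems.PercNearOneGluingNoHeavyPcintBSMRZ4QSCert
import HarnessLib

/-!
# PCINT lane, PHASE 11 (site plane method for `d = 4`, reach-4 pieces (two-turn family)): kernel check 16/24 of the site certificate inequalities for `ℤ^4` at the cell `0.3770`

Cell `prim-pcint`, seat `prim-pcint-1` (gen 18); memo `run/shared/lean/prim/pcint/T-FIBRE-ROUTE.md` §PHASE 11.
Instance `Z4QS`: `d = 4 = 2 + 2` (`k = 2` time axes, the transverse plane), SITE percolation, reach-4 pieces,
9-point law `A/DA = [12, 25, 35, 80, 696, 80, 35, 25, 12]/1000`, horizon `N = 1000` in `20` chunks of `50` (window half-width `250`),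
Fourier tail (cut-off data, `θ₀ = 1/3`) `T = 3781802960/10^12`, cell `p = 3770/10^4`. One `decide +kernel` per
representative (kernel memory), bit-mask site functional `BSMR.certFastMS`.
-/

namespace Summit.CriticalPhenomena.PercolationContinuityZ3.Theorems.Pcint.BSMR.Z4QS

open Summit.CriticalPhenomena.PercolationContinuityZ3.Theorems.Pcint.BSMR Summit.CriticalPhenomena.PercolationContinuityZ3.Theorems.Pcint.BSMX Summit.CriticalPhenomena.PercolationContinuityZ3.Theorems.Pcint.BSM

set_option maxHeartbeats 0 in
set_option maxRecDepth 65536 in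
/-- The site certificate inequality at `![3, 2]` (cell `0.3770`, site `ℤ^4`). -/
theorem hrep_16a : ∀ y ∈ [(![3, 2] : Fin 2 → ℤ)], certFastMS RS 2 10000 3770 9 V0t V1t (tr2 y) (shOfV (tr2 y)) ≤ Φn y * (3770 ^ 9 * 2 * 840000000 ^ 2 * (1000000000000 * 1)) := by
  decide +kernel

/-- The site certificate inequalities on the offsets `((reps8.drop 36).take 1)` (cell `0.3770`). -/
theorem hrep_16 : ∀ y ∈ ((reps8.drop 36).take 1), certFastMS RS 2 10000 3770 9 V0t V1t (tr2 y) (shOfV (tr2 y)) ≤ Φn y * (3770 ^ 9 * 2 * 840000000 ^ 2 * (1000000000000 * 1)) := by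
  intro y hy
  have hl : ((reps8.drop 36).take 1) = [(![3, 2] : Fin 2 → ℤ)] := by decide +kernel
  rw [hl] at hy
  simp only [List.mem_cons, List.not_mem_nil, or_false] at hy
  subst hy
  · exact hrep_16a _ (List.mem_singleton.2 rfl)

end Summit.CriticalPhenomena.PercolationContinuityZ3.Theorems.Pcint.BSMR.Z4QS
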